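import Literature.NumberTheory.Automorphic.UnramifiedOrbitSetHermitian
import Literature.LinearAlgebra.Matrix.IntegralUnitaryConjugacyComplete
import Literature.NumberTheory.Automorphic.AdicCompletionCompact
import Literature.RingTheory.DiscreteValuationRing.AdicCompletionHensel
import HarnessLib

/-!
# Integral conjugacy in `U(J)(F_v)` at almost every place: two points of the hyperspecial level `U(J)(𝒪_v)` with the same regular characteristic
# polynomial are `U(J)(𝒪_v)`-conjugate — Kottwitz's Prop. 7.1 in the `K_v`-CONJUGACY form
(Kottwitz, *Stable trace formula: elliptic singular terms* (1986), Prop. 7.1; Rogawski (1990), §3.3 p. 21: «γ′_v is conjugate to γ by an element of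
`K_v` for almost all `v`»)

Topic `NumberTheory/Automorphic`; namespace `Literature.NumberTheory.Automorphic.UnitaryGroup`; THEOREMS ONLY (no definition, no instance, no named fact, no `sorry`).  Inputs, all ★: F1 `IntegralConjugacyOfRegularElements`
(`exists_isUnit_det_conj_of_charpoly_eq`: `GL_N(𝒪_w)`-conjugacy over a local ring), F2-c `IntegralUnitaryConjugacyComplete`
(`exists_integral_unitary_conj_of_charpoly_eq_of_isAdicComplete`: the UNITARY integral conjugacy, hypothesis-free over a complete local ring with
finite residue field and an involution moving some element by a unit), the transport files `UnramifiedOrbitSetSplit` ∕ `…Nonsplit` ∕ `…Local`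
∕ `…Hermitian` (★ `localSplitEquiv`, ★ `localNonsplitEquiv`, ★ `mem_range_map_adicCompletionIntegers_iff_mem_glInt`, ★ `eventually_exists_separable_lift`,
★ `exists_isUnit_map_sub_of_isUnramifiedIn`), the
instances ★ `adicCompletionIntegers.isAdicComplete` and ★ `finite_residueField_adicCompletion` on `𝒪_w = w.adicCompletionIntegers E`.

* §1 `integralConj_of_mulEquiv` — transport of «`∃ k ∈ K, k γ k⁻¹ = g`» along a group isomorphism matching the levels.
* §2 SPLIT `w ∣ v`: **`integralConj_of_split`** — for `γ ⊗ 1 ∈ U(J)(F_v)` with `γ_w ∈ GL_N(𝒪_w)` and a separable integral model of `p_γ`, every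
  `g′ ∈ U(J)(𝒪_v)` with `p_{g′} = p_{γ ⊗ 1}` (over `E ⊗ F_v`) is `U(J)(𝒪_v)`-conjugate to `γ ⊗ 1` (★ F1 along ★ `localSplitEquiv`).
* §3 NON-SPLIT unramified `w ∣ v`: **`integralConj_unitaryGroupOfForm`** — the one-place statement in `U(σ_w, J_w)(E_w)` with `K = U ∩ GL_N(𝒪_w)`,
  hypothesis-free (★ F2-c at `𝒪 = 𝒪_w`), and **`integralConj_of_nonsplit`** (along ★ `localNonsplitEquiv`).
* §4 **`eventually_forall_integralConj`** — for `c ≠ 1`, `J` `c`-hermitian with `det J` a unit, `γ ∈ GL_N(E)` with separable characteristic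
  polynomial and `γ ⊗ 1 ∈ U(J)(F_v)` for all `v`: for all but finitely many `v`, every `g′ ∈ U(J)(𝒪_v)` with the characteristic polynomial of
  `γ ⊗ 1` is conjugate to `γ ⊗ 1` BY AN ELEMENT OF `U(J)(𝒪_v)`.

The CM dress and the discharge of the named fact ★ `Rogawski1990.MatchingAdeleGEventuallyKConj` are the companion
`Rogawski1990/MatchingAdeleGKConjHolds` (10 lines over §4).

## References
* R. E. Kottwitz, *Stable trace formula: elliptic singular terms*, Math. Ann. 275 (1986), §7, Prop. 7.1, Cor. 7.3 [Kottwitz1986].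
* J. D. Rogawski, *Automorphic Representations of Unitary Groups in Three Variables*, Ann. of Math. Stud. 123 (1990), §3.3 p. 21 (print)
  [Rogawski1990].
* J.-P. Serre, *Local Fields*, GTM 67 (1979), Ch. I §7 Prop. 20–21, Ch. V §2 [Serre1979].
-/

set_option autoImplicit false

noncomputable section

open NumberField IsDedekindDomain Filter Polynomial
open scoped Matrix Pointwise

namespace Literature.NumberTheory.Automorphic.UnitaryGroup

/-! ## §1 Transport of integral conjugacy -/


section Transport

variable {G G' : Type*} [Group G] [Group G']

/-- **Integral conjugacy transports along a group isomorphism matching the subgroups**: if `e : G ≃* G'`, `k ∈ K ↔ e k ∈ K'`, and `e g` is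
`K'`-conjugate to `e γ`, then `g` is `K`-conjugate to `γ`. [cite: Kottwitz1986, Prop. 7.1] -/
theorem integralConj_of_mulEquiv (e : G ≃* G') (K : Subgroup G) (K' : Subgroup G') (hK : ∀ g, g ∈ K ↔ e g ∈ K') (γ g : G)
    (h : ∃ k' ∈ K', k' * e γ * k'⁻¹ = e g) : ∃ k ∈ K, k * γ * k⁻¹ = g := by
  obtain ⟨k', hk', hk⟩ := h
  refine ⟨e.symm k', (hK _).2 (by rw [MulEquiv.apply_symm_apply]; exact hk'), e.injective ?_⟩
  rw [map_mul, map_mul, map_inv, MulEquiv.apply_symm_apply, hk]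

end Transport

/-! ## §2 The split place: `GL_N(𝒪_w)`-conjugacy -/

section Split

variable {F E : Type} [Field F] [NumberField F] [Field E] [NumberField E] [Algebra F E]
  (c : E ≃ₐ[F] E) (N : ℕ) (J : Matrix (Fin N) (Fin N) E)

variable [Algebra.IsQuadraticExtension F E] {v : HeightOneSpectrum (𝓞 F)}

/-- **Integral conjugacy at a split place.**  Let `w ∣ v` be split (`c • w ≠ w`), `J` `c`-hermitian with `J_w ∈ GL_N(𝒪_w)`, and `g = γ ⊗ 1 ∈ U(J)(F_v)`
(`γ ∈ GL_N(E)`) with `γ_w ∈ GL_N(𝒪_w)` and an integral model of `p_γ` separable modulo `𝔪_w`.  Then every `g′ ∈ U(J)(𝒪_v)` whose characteristic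
polynomial (in `GL_N(E ⊗ F_v)`) equals that of `g` is conjugate to `g` by an element of `U(J)(𝒪_v)` — ★ F1 `exists_isUnit_det_conj_of_charpoly_eq`
over `𝒪_w` read through ★ `localSplitEquiv : U(J)(F_v) ≃ GL_N(E_w)` ∕ ★ `mem_localIntegralLevel_iff_of_ne`. [cite: Kottwitz1986, Prop. 7.1]
[cite: Rogawski1990, §3.3 p. 21] -/
theorem integralConj_of_split (hc : c ≠ 1) (hJh : (J.map c)ᵀ = J) (w : PlacesOver E v) (hw : c • w.1 ≠ w.1) (hJw : IsUnit (placeForm J w.1))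
    (hJi : hJw.unit ∈ glInt N (w.1.adicCompletion E)) (γ : GL (Fin N) E) (g : «local» E c N J v)
    (hg : (g : GL (Fin N) (LocalRing E v)) = toLocalGL E v γ)
    (hγw : Matrix.GeneralLinearGroup.map (algebraMap E (w.1.adicCompletion E)) γ ∈ glInt N (w.1.adicCompletion E))
    (hsep : ∃ q : (w.1.adicCompletionIntegers E)[X],
      q.map (w.1.adicCompletionIntegers E).subtype = (γ : Matrix (Fin N) (Fin N) E).charpoly.map (algebraMap E (w.1.adicCompletion E)) ∧
        (q.map (IsLocalRing.residue (w.1.adicCompletionIntegers E))).Separable)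
    (g' : «local» E c N J v) (hg' : g' ∈ localIntegralLevel c N J v)
    (hchar : (((g' : GL (Fin N) (LocalRing E v)) : Matrix (Fin N) (Fin N) (LocalRing E v))).charpoly =
      (((g : GL (Fin N) (LocalRing E v)) : Matrix (Fin N) (Fin N) (LocalRing E v))).charpoly) :
    ∃ k ∈ localIntegralLevel c N J v, k * g * k⁻¹ = g' := by
  -- integral lifts `γ̃`, `g̃′ ∈ GL_N(𝒪_w)` of `γ_w` and `g′_w`
  obtain ⟨γw, hγw'⟩ := (mem_range_map_adicCompletionIntegers_iff_mem_glInt N w.1 _).2 hγw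
  have hg'w : localSplitEquiv c J hc hJh w hw hJw g' ∈ glInt N (w.1.adicCompletion E) :=
    (mem_localIntegralLevel_iff_of_ne c N J hc hJh w hw hJw hJi g').1 hg'
  obtain ⟨gw, hgw'⟩ := (mem_range_map_adicCompletionIntegers_iff_mem_glInt N w.1 _).2 hg'w
  obtain ⟨q, hq, hqsep⟩ := hsep
  have he : localSplitEquiv c J hc hJh w hw hJw g = Matrix.GeneralLinearGroup.map (w.1.adicCompletionIntegers E).subtype γw := by
    rw [hγw']
    exact localSplitEquiv_eq_map_of_eq_toLocalGL c N J hc hJh w hw hJw γ g hg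
  -- characteristic polynomials of the lifts
  have hcharγ : (γw : Matrix (Fin N) (Fin N) (w.1.adicCompletionIntegers E)).charpoly = q := by
    apply Polynomial.map_injective (w.1.adicCompletionIntegers E).subtype Subtype.val_injective
    rw [hq, ← Matrix.charpoly_map, ← Matrix.charpoly_map]
    congr 1
    exact congrArg (fun u : GL (Fin N) (w.1.adicCompletion E) => (u : Matrix (Fin N) (Fin N) (w.1.adicCompletion E))) hγw'
  have hsep' : ((γw : Matrix (Fin N) (Fin N) (w.1.adicCompletionIntegers E)).charpoly.map
      (IsLocalRing.residue (w.1.adicCompletionIntegers E))).Separable := by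
    rw [hcharγ]; exact hqsep
  have hcharw : ∀ u : «local» E c N J v, (((localSplitEquiv c J hc hJh w hw hJw u : GL (Fin N) (w.1.adicCompletion E)) :
      Matrix (Fin N) (Fin N) (w.1.adicCompletion E))).charpoly =
      (((u : GL (Fin N) (LocalRing E v)) : Matrix (Fin N) (Fin N) (LocalRing E v))).charpoly.map
        (Pi.evalRingHom (fun w' : PlacesOver E v => w'.1.adicCompletion E) w) := fun u => by
    rw [coe_localSplitEquiv_apply, Matrix.charpoly_map]
  have hchar' : (gw : Matrix (Fin N) (Fin N) (w.1.adicCompletionIntegers E)).charpoly =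
      (γw : Matrix (Fin N) (Fin N) (w.1.adicCompletionIntegers E)).charpoly := by
    apply Polynomial.map_injective (w.1.adicCompletionIntegers E).subtype Subtype.val_injective
    rw [← Matrix.charpoly_map, ← Matrix.charpoly_map]
    have h1 := congrArg (fun u : GL (Fin N) (w.1.adicCompletion E) => (u : Matrix (Fin N) (Fin N) (w.1.adicCompletion E))) hgw'
    have h2 := congrArg (fun u : GL (Fin N) (w.1.adicCompletion E) => (u : Matrix (Fin N) (Fin N) (w.1.adicCompletion E))) he
    change (gw : Matrix (Fin N) (Fin N) (w.1.adicCompletionIntegers E)).map _ = _ at h1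
    change _ = (γw : Matrix (Fin N) (Fin N) (w.1.adicCompletionIntegers E)).map _ at h2
    rw [h1, ← h2, hcharw, hcharw, hchar]
  -- F1: `g̃′ P = P γ̃` with `P ∈ GL_N(𝒪_w)`
  obtain ⟨P, hP, hPconj⟩ := Literature.LinearAlgebra.Matrix.exists_isUnit_det_conj_of_charpoly_eq
    (γw : Matrix (Fin N) (Fin N) (w.1.adicCompletionIntegers E)) gw hsep' hchar'
  have hPu : IsUnit P := (Matrix.isUnit_iff_isUnit_det P).2 hP
  -- transport along `localSplitEquiv`
  refine integralConj_of_mulEquiv (localSplitEquiv c J hc hJh w hw hJw).toMulEquiv (localIntegralLevel c N J v) (glInt N (w.1.adicCompletion E))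
    (fun u => mem_localIntegralLevel_iff_of_ne c N J hc hJh w hw hJw hJi u) g g'
    ⟨Matrix.GeneralLinearGroup.map (w.1.adicCompletionIntegers E).subtype hPu.unit,
      (mem_range_map_adicCompletionIntegers_iff_mem_glInt N w.1 _).1 ⟨hPu.unit, rfl⟩, ?_⟩
  change Matrix.GeneralLinearGroup.map (w.1.adicCompletionIntegers E).subtype hPu.unit * localSplitEquiv c J hc hJh w hw hJw g *
      (Matrix.GeneralLinearGroup.map (w.1.adicCompletionIntegers E).subtype hPu.unit)⁻¹ = localSplitEquiv c J hc hJh w hw hJw g'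
  rw [he, ← hgw', ← map_inv, ← map_mul, ← map_mul]
  congr 1
  refine Units.ext ?_
  rw [Units.val_mul, Units.val_mul, IsUnit.unit_spec, Matrix.coe_units_inv, IsUnit.unit_spec]
  calc P * (γw : Matrix (Fin N) (Fin N) (w.1.adicCompletionIntegers E)) * P⁻¹
      = (gw : Matrix (Fin N) (Fin N) (w.1.adicCompletionIntegers E)) * P * P⁻¹ := by rw [hPconj]
    _ = gw := Matrix.mul_nonsing_inv_cancel_right P _ hP

end Split

/-! ## §3 The non-split unramified place: unitary integral conjugacy in `U(σ_w, J_w)(E_w)`, hypothesis-free -/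

section Nonsplit

variable {F E : Type} [Field F] [NumberField F] [Field E] [NumberField E] [Algebra F E]
  (c : E ≃ₐ[F] E) (N : ℕ) (J : Matrix (Fin N) (Fin N) E)

variable [Algebra.IsQuadraticExtension F E] {v : HeightOneSpectrum (𝓞 F)}

/-- **Kottwitz's Prop. 7.1 in the one-place unitary group `U(σ_w, J_w)(E_w)`, `K = U ∩ GL_N(𝒪_w)`, hypothesis-free.**  Let `w ∣ v` be non-split
(`c • w = w`) with `v` UNRAMIFIED in `E`, `J` `c`-hermitian with `J_w ∈ GL_N(𝒪_w)`, and `γ_w ∈ U(σ_w, J_w)(E_w) ∩ GL_N(𝒪_w)` with an integral model of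
its characteristic polynomial separable modulo `𝔪_w`.  Then every `g_w ∈ U ∩ GL_N(𝒪_w)` with the same characteristic polynomial is conjugate to `γ_w`
by an element of `U ∩ GL_N(𝒪_w)` — ★ `exists_integral_unitary_conj_of_charpoly_eq_of_isAdicComplete` over `𝒪_w = w.adicCompletionIntegers E` (complete:
★ `adicCompletionIntegers.isAdicComplete`; finite residue field: ★ `finite_residueField_adicCompletion`; `σ_w` moves a unit: ★ `exists_isUnit_map_sub_of_isUnramifiedIn`).
[cite: Kottwitz1986, Prop. 7.1] [cite: Rogawski1990, §3.3 p. 21] -/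
theorem integralConj_unitaryGroupOfForm (hc : c ≠ 1) (hJh : (J.map c)ᵀ = J) (w : PlacesOver E v) (hw : c • w.1 = w.1)
    (hv : Algebra.IsUnramifiedIn (𝓞 E) v.asIdeal) (hJw : IsUnit (placeForm J w.1)) (hJi : hJw.unit ∈ glInt N (w.1.adicCompletion E))
    (γw : unitaryGroupOfForm (galAdicCompletionMap (L := E) c hw) (placeForm J w.1))
    (hγint : (γw : GL (Fin N) (w.1.adicCompletion E)) ∈ glInt N (w.1.adicCompletion E))
    (hsep : ∃ q : (w.1.adicCompletionIntegers E)[X],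
      q.map (w.1.adicCompletionIntegers E).subtype =
          (((γw : GL (Fin N) (w.1.adicCompletion E)) : Matrix (Fin N) (Fin N) (w.1.adicCompletion E))).charpoly ∧
        (q.map (IsLocalRing.residue (w.1.adicCompletionIntegers E))).Separable)
    (gw : unitaryGroupOfForm (galAdicCompletionMap (L := E) c hw) (placeForm J w.1))
    (hgint : (gw : GL (Fin N) (w.1.adicCompletion E)) ∈ glInt N (w.1.adicCompletion E))
    (hchar : (((gw : GL (Fin N) (w.1.adicCompletion E)) : Matrix (Fin N) (Fin N) (w.1.adicCompletion E))).charpoly =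
      (((γw : GL (Fin N) (w.1.adicCompletion E)) : Matrix (Fin N) (Fin N) (w.1.adicCompletion E))).charpoly) :
    ∃ k ∈ (glInt N (w.1.adicCompletion E)).subgroupOf (unitaryGroupOfForm (galAdicCompletionMap (L := E) c hw) (placeForm J w.1)),
      k * γw * k⁻¹ = gw := by
  have hfinj : Function.Injective (w.1.adicCompletionIntegers E).subtype := Subtype.val_injective
  -- the instances on `𝒪_w`
  haveI : Finite (IsLocalRing.ResidueField (w.1.adicCompletionIntegers E)) := finite_residueField_adicCompletion E w.1
  -- the integral involution
  let σO : w.1.adicCompletionIntegers E →+* w.1.adicCompletionIntegers E :=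
    (galAdicCompletionMap (L := E) c hw).restrict (w.1.adicCompletionIntegers E) (w.1.adicCompletionIntegers E)
      fun x hx => (galAdicCompletionMap_mem_adicCompletionIntegers_iff E c hw x).2 hx
  have hσO : ∀ x : w.1.adicCompletionIntegers E, ((σO x : w.1.adicCompletionIntegers E) : w.1.adicCompletion E) =
      galAdicCompletionMap (L := E) c hw x := fun _ => rfl
  have hfσ : ∀ x : w.1.adicCompletionIntegers E, (w.1.adicCompletionIntegers E).subtype (σO x) =
      galAdicCompletionMap (L := E) c hw ((w.1.adicCompletionIntegers E).subtype x) := fun _ => rfl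
  have hσσ : ∀ x, σO (σO x) = x := fun x => Subtype.ext (galAdicCompletionMap_galAdicCompletionMap_of_smul_eq c w hc hw x)
  have hcomp : (⇑(w.1.adicCompletionIntegers E).subtype ∘ ⇑σO) =
      ⇑(galAdicCompletionMap (L := E) c hw) ∘ ⇑(w.1.adicCompletionIntegers E).subtype := funext fun x => hσO x
  obtain ⟨a, ha⟩ := exists_isUnit_map_sub_of_isUnramifiedIn c w hc hw hv σO hσO
  -- the integral lift `J̃` of `J_w`
  obtain ⟨Ju, hJu⟩ := (mem_range_map_adicCompletionIntegers_iff_mem_glInt N w.1 _).2 hJi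
  have hJtf : (Ju : Matrix (Fin N) (Fin N) (w.1.adicCompletionIntegers E)).map (w.1.adicCompletionIntegers E).subtype = placeForm J w.1 := by
    have h := congrArg (fun g : GL (Fin N) (w.1.adicCompletion E) => (g : Matrix (Fin N) (Fin N) (w.1.adicCompletion E))) hJu
    rw [IsUnit.unit_spec] at h
    exact h
  have hJt : ((Ju : Matrix (Fin N) (Fin N) (w.1.adicCompletionIntegers E)).map σO)ᵀ = Ju := by
    apply Matrix.map_injective hfinj
    change (((Units.val Ju).map σO)ᵀ).map _ = (Units.val Ju).map _
    rw [Matrix.transpose_map, Matrix.map_map, hcomp, ← Matrix.map_map, hJtf]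
    exact placeForm_hermitian_of_smul_eq c w J hJh hw
  have hJtdet : IsUnit (Ju : Matrix (Fin N) (Fin N) (w.1.adicCompletionIntegers E)).det :=
    (Matrix.isUnit_iff_isUnit_det _).1 Ju.isUnit
  -- the integral lifts `γ̃`, `g̃`: unitary, same characteristic polynomial, separable reduction
  obtain ⟨γu, hγu⟩ := (mem_range_map_adicCompletionIntegers_iff_mem_glInt N w.1 _).2 hγint
  obtain ⟨gu, hgu⟩ := (mem_range_map_adicCompletionIntegers_iff_mem_glInt N w.1 _).2 hgint
  have hγtf : (γu : Matrix (Fin N) (Fin N) (w.1.adicCompletionIntegers E)).map (w.1.adicCompletionIntegers E).subtype =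
      ((γw : GL (Fin N) (w.1.adicCompletion E)) : Matrix (Fin N) (Fin N) (w.1.adicCompletion E)) :=
    congrArg (fun g : GL (Fin N) (w.1.adicCompletion E) => (g : Matrix (Fin N) (Fin N) (w.1.adicCompletion E))) hγu
  have hgtf : (gu : Matrix (Fin N) (Fin N) (w.1.adicCompletionIntegers E)).map (w.1.adicCompletionIntegers E).subtype =
      ((gw : GL (Fin N) (w.1.adicCompletion E)) : Matrix (Fin N) (Fin N) (w.1.adicCompletion E)) :=
    congrArg (fun g : GL (Fin N) (w.1.adicCompletion E) => (g : Matrix (Fin N) (Fin N) (w.1.adicCompletion E))) hgu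
  have hγtU : ((γu : Matrix (Fin N) (Fin N) (w.1.adicCompletionIntegers E)).map σO)ᵀ * Ju * γu = Ju := by
    apply Literature.LinearAlgebra.Matrix.formUnitary_of_formUnitary_map (w.1.adicCompletionIntegers E).subtype hfinj hfσ
    rw [hγtf, hJtf]
    exact γw.2
  have hgtU : ((gu : Matrix (Fin N) (Fin N) (w.1.adicCompletionIntegers E)).map σO)ᵀ * Ju * gu = Ju := by
    apply Literature.LinearAlgebra.Matrix.formUnitary_of_formUnitary_map (w.1.adicCompletionIntegers E).subtype hfinj hfσ
    rw [hgtf, hJtf]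
    exact gw.2
  obtain ⟨q, hq, hqsep⟩ := hsep
  have hcharγ : (γu : Matrix (Fin N) (Fin N) (w.1.adicCompletionIntegers E)).charpoly = q := by
    apply Polynomial.map_injective (w.1.adicCompletionIntegers E).subtype hfinj
    rw [hq, ← Matrix.charpoly_map, hγtf]
  have hsep' : ((γu : Matrix (Fin N) (Fin N) (w.1.adicCompletionIntegers E)).charpoly.map
      (IsLocalRing.residue (w.1.adicCompletionIntegers E))).Separable := by rw [hcharγ]; exact hqsep
  have hchar' : (gu : Matrix (Fin N) (Fin N) (w.1.adicCompletionIntegers E)).charpoly =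
      (γu : Matrix (Fin N) (Fin N) (w.1.adicCompletionIntegers E)).charpoly := by
    apply Polynomial.map_injective (w.1.adicCompletionIntegers E).subtype hfinj
    rw [← Matrix.charpoly_map, ← Matrix.charpoly_map, hγtf, hgtf, hchar]
  -- F2-c: `g̃ k = k γ̃` with `k` unitary integral
  obtain ⟨k, hk, hkU, hkconj⟩ :=
    Literature.LinearAlgebra.Matrix.exists_integral_unitary_conj_of_charpoly_eq_of_isAdicComplete σO hσσ ha hJt hJtdet hsep' hchar' hγtU hgtU
  -- package `k ⊗ 1 ∈ U ∩ GL_N(𝒪_w)`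
  have hkf : IsUnit (k.map (w.1.adicCompletionIntegers E).subtype) :=
    (Matrix.isUnit_iff_isUnit_det _).2 (by rw [← RingHom.mapMatrix_apply, ← RingHom.map_det]; exact hk.map _)
  have hkmem : hkf.unit ∈ unitaryGroupOfForm (galAdicCompletionMap (L := E) c hw) (placeForm J w.1) := by
    rw [mem_unitaryGroupOfForm_iff, IsUnit.unit_spec, ← hJtf]
    exact Literature.LinearAlgebra.Matrix.formUnitary_map_of_formUnitary (w.1.adicCompletionIntegers E).subtype hfσ hkU
  refine ⟨⟨hkf.unit, hkmem⟩, ?_, ?_⟩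
  · rw [Subgroup.mem_subgroupOf]
    change hkf.unit ∈ glInt N (w.1.adicCompletion E)
    refine (mem_range_map_adicCompletionIntegers_iff_mem_glInt N w.1 _).1 ⟨((Matrix.isUnit_iff_isUnit_det k).2 hk).unit, Units.ext ?_⟩
    rw [IsUnit.unit_spec]
    change ((((Matrix.isUnit_iff_isUnit_det k).2 hk).unit : Matrix (Fin N) (Fin N) (w.1.adicCompletionIntegers E))).map _ = _
    rw [IsUnit.unit_spec]
  · -- `(k ⊗ 1) γ_w (k ⊗ 1)⁻¹ = g_w`: from `g̃ k = k γ̃`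
    refine Subtype.ext (Units.ext ?_)
    change (((⟨hkf.unit, hkmem⟩ * γw : unitaryGroupOfForm (galAdicCompletionMap (L := E) c hw) (placeForm J w.1)) :
        GL (Fin N) (w.1.adicCompletion E)) : Matrix (Fin N) (Fin N) (w.1.adicCompletion E)) *
        (((⟨hkf.unit, hkmem⟩ : unitaryGroupOfForm (galAdicCompletionMap (L := E) c hw) (placeForm J w.1))⁻¹ :
          unitaryGroupOfForm (galAdicCompletionMap (L := E) c hw) (placeForm J w.1)) : GL (Fin N) (w.1.adicCompletion E)) = _
    rw [Subgroup.coe_mul, Subgroup.coe_inv, Units.val_mul, Matrix.coe_units_inv]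
    change k.map (w.1.adicCompletionIntegers E).subtype * ((γw : GL (Fin N) (w.1.adicCompletion E)) : Matrix (Fin N) (Fin N) (w.1.adicCompletion E)) *
        (k.map (w.1.adicCompletionIntegers E).subtype)⁻¹ = ((gw : GL (Fin N) (w.1.adicCompletion E)) : Matrix (Fin N) (Fin N) (w.1.adicCompletion E))
    have hkfdet : IsUnit (k.map (w.1.adicCompletionIntegers E).subtype).det := (Matrix.isUnit_iff_isUnit_det _).1 hkf
    have hconjf : (gu : Matrix (Fin N) (Fin N) (w.1.adicCompletionIntegers E)).map (w.1.adicCompletionIntegers E).subtype *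
        k.map (w.1.adicCompletionIntegers E).subtype =
        k.map (w.1.adicCompletionIntegers E).subtype * (γu : Matrix (Fin N) (Fin N) (w.1.adicCompletionIntegers E)).map (w.1.adicCompletionIntegers E).subtype := by
      rw [← Matrix.map_mul, ← Matrix.map_mul, hkconj]
    rw [← hγtf, ← hgtf, ← hconjf, Matrix.mul_nonsing_inv_cancel_right _ _ hkfdet]

/-- **Integral conjugacy at a non-split unramified place**, transported to `U(J)(F_v)`: for `g = γ ⊗ 1 ∈ U(J)(F_v)` (`γ ∈ GL_N(E)`) with `γ_w ∈ GL_N(𝒪_w)`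
and a separable integral model of `p_γ` at the non-split `w ∣ v` (`v` unramified, `J_w ∈ GL_N(𝒪_w)`), every `g′ ∈ U(J)(𝒪_v)` with the characteristic
polynomial of `g` is conjugate to `g` by an element of `U(J)(𝒪_v)` (§3 along ★ `localNonsplitEquiv` ∕ ★ `mem_localIntegralLevel_iff_of_smul_eq`).
[cite: Kottwitz1986, Prop. 7.1] [cite: Rogawski1990, §3.3 p. 21] -/
theorem integralConj_of_nonsplit (hc : c ≠ 1) (hJh : (J.map c)ᵀ = J) (w : PlacesOver E v) (hw : c • w.1 = w.1)
    (hv : Algebra.IsUnramifiedIn (𝓞 E) v.asIdeal) (hJw : IsUnit (placeForm J w.1)) (hJi : hJw.unit ∈ glInt N (w.1.adicCompletion E))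
    (γ : GL (Fin N) E) (g : «local» E c N J v) (hg : (g : GL (Fin N) (LocalRing E v)) = toLocalGL E v γ)
    (hγw : Matrix.GeneralLinearGroup.map (algebraMap E (w.1.adicCompletion E)) γ ∈ glInt N (w.1.adicCompletion E))
    (hsep : ∃ q : (w.1.adicCompletionIntegers E)[X],
      q.map (w.1.adicCompletionIntegers E).subtype = (γ : Matrix (Fin N) (Fin N) E).charpoly.map (algebraMap E (w.1.adicCompletion E)) ∧
        (q.map (IsLocalRing.residue (w.1.adicCompletionIntegers E))).Separable)
    (g' : «local» E c N J v) (hg' : g' ∈ localIntegralLevel c N J v)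
    (hchar : (((g' : GL (Fin N) (LocalRing E v)) : Matrix (Fin N) (Fin N) (LocalRing E v))).charpoly =
      (((g : GL (Fin N) (LocalRing E v)) : Matrix (Fin N) (Fin N) (LocalRing E v))).charpoly) :
    ∃ k ∈ localIntegralLevel c N J v, k * g * k⁻¹ = g' := by
  have he : ((localNonsplitEquiv c J hc w hw g : unitaryGroupOfForm (galAdicCompletionMap (L := E) c hw) (placeForm J w.1)) :
      GL (Fin N) (w.1.adicCompletion E)) = Matrix.GeneralLinearGroup.map (algebraMap E (w.1.adicCompletion E)) γ :=
    localNonsplitEquiv_eq_map_of_eq_toLocalGL c N J hc w hw γ g hg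
  have hcharw : ∀ u : «local» E c N J v,
      ((((localNonsplitEquiv c J hc w hw u : unitaryGroupOfForm (galAdicCompletionMap (L := E) c hw) (placeForm J w.1)) :
        GL (Fin N) (w.1.adicCompletion E)) : Matrix (Fin N) (Fin N) (w.1.adicCompletion E))).charpoly =
      (((u : GL (Fin N) (LocalRing E v)) : Matrix (Fin N) (Fin N) (LocalRing E v))).charpoly.map
        (Pi.evalRingHom (fun w' : PlacesOver E v => w'.1.adicCompletion E) w) := fun u => by
    rw [← Matrix.charpoly_map]
    rfl
  obtain ⟨q, hq, hqsep⟩ := hsep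
  refine integralConj_of_mulEquiv (localNonsplitEquiv c J hc w hw).toMulEquiv (localIntegralLevel c N J v)
    ((glInt N (w.1.adicCompletion E)).subgroupOf (unitaryGroupOfForm (galAdicCompletionMap (L := E) c hw) (placeForm J w.1)))
    (fun u => by rw [Subgroup.mem_subgroupOf]; exact mem_localIntegralLevel_iff_of_smul_eq c N J hc w hw u) g g' ?_
  refine integralConj_unitaryGroupOfForm c N J hc hJh w hw hv hJw hJi _ (by
      change ((localNonsplitEquiv c J hc w hw g : unitaryGroupOfForm (galAdicCompletionMap (L := E) c hw) (placeForm J w.1)) :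
        GL (Fin N) (w.1.adicCompletion E)) ∈ _
      rw [he]; exact hγw) ⟨q, ?_, hqsep⟩ _
    ((mem_localIntegralLevel_iff_of_smul_eq c N J hc w hw g').1 hg') ?_
  · rw [hq]
    change _ = ((((localNonsplitEquiv c J hc w hw g : unitaryGroupOfForm (galAdicCompletionMap (L := E) c hw) (placeForm J w.1)) :
      GL (Fin N) (w.1.adicCompletion E)) : Matrix (Fin N) (Fin N) (w.1.adicCompletion E))).charpoly
    rw [he, ← Matrix.charpoly_map]
    rfl
  · change ((((localNonsplitEquiv c J hc w hw g' : unitaryGroupOfForm (galAdicCompletionMap (L := E) c hw) (placeForm J w.1)) :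
        GL (Fin N) (w.1.adicCompletion E)) : Matrix (Fin N) (Fin N) (w.1.adicCompletion E))).charpoly =
      ((((localNonsplitEquiv c J hc w hw g : unitaryGroupOfForm (galAdicCompletionMap (L := E) c hw) (placeForm J w.1)) :
        GL (Fin N) (w.1.adicCompletion E)) : Matrix (Fin N) (Fin N) (w.1.adicCompletion E))).charpoly
    rw [hcharw, hcharw, hchar]

end Nonsplit

/-! ## §4 Almost every place: split ∨ non-split -/

section AE

variable {F E : Type} [Field F] [NumberField F] [Field E] [NumberField E] [Algebra F E]
  (c : E ≃ₐ[F] E) (N : ℕ) (J : Matrix (Fin N) (Fin N) E)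

/-- Only finitely many places of `F` ramify in `E` (private copy of ★ B9's lemma: the ramified places lie below the prime factors of the
different). [folklore] -/
private theorem finite_setOf_not_isUnramifiedIn' :
    {v : HeightOneSpectrum (𝓞 F) | ¬ Algebra.IsUnramifiedIn (𝓞 E) v.asIdeal}.Finite := by
  have hD : differentIdeal (𝓞 F) (𝓞 E) ≠ ⊥ := differentIdeal_ne_bot
  have hfin : {Q : HeightOneSpectrum (𝓞 E) | Q.asIdeal ∣ differentIdeal (𝓞 F) (𝓞 E)}.Finite :=
    Ideal.finite_factors hD
  refine (hfin.image fun Q => Q.under (𝓞 F)).subset ?_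
  intro q hq
  simp only [Set.mem_setOf_eq, Algebra.IsUnramifiedIn, not_forall] at hq
  obtain ⟨Q, hQprime, hQover, hQunr⟩ := hq
  haveI := hQprime
  have hQne : Q ≠ ⊥ := Ideal.ne_bot_of_liesOver_of_ne_bot q.ne_bot Q
  refine ⟨⟨Q, hQprime, hQne⟩, ?_, ?_⟩
  · exact dvd_differentIdeal_iff.mpr hQunr
  · exact HeightOneSpectrum.ext hQover.over.symm

variable [Algebra.IsQuadraticExtension F E]

/-- **Kottwitz's Prop. 7.1 in the `K_v`-conjugacy form, at almost every place of `F`.**  For `c ≠ 1`, a `c`-hermitian `J` with `det J` a unit, and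
`γ ∈ GL_N(E)` with SEPARABLE characteristic polynomial such that `γ ⊗ 1 ∈ U(J)(F_v)` for every `v` (the elements `g v`): for all but finitely many
finite places `v` of `F` — off the ramified places, the places with `J_w ∉ GL_N(𝒪_w)` or `γ_w ∉ GL_N(𝒪_w)`, and those where `p_γ` has no separable integral
model — EVERY `g′ ∈ U(J)(𝒪_v)` whose characteristic polynomial (in `GL_N(E ⊗ F_v)`) is that of `γ ⊗ 1` is conjugate to `γ ⊗ 1` by an element of
`U(J)(𝒪_v)` («γ′_v is conjugate to γ by an element of `K_v` for almost all `v`»; split places §2, inert places §3).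
[cite: Kottwitz1986, Prop. 7.1; Cor. 7.3] [cite: Rogawski1990, §3.3 p. 21] -/
theorem eventually_forall_integralConj (hc : c ≠ 1) (hJh : (J.map c)ᵀ = J) (hJ : IsUnit J.det) (γ : GL (Fin N) E)
    (hγ : ((γ : Matrix (Fin N) (Fin N) E).charpoly).Separable) (g : ∀ v : HeightOneSpectrum (𝓞 F), «local» E c N J v)
    (hg : ∀ v, (g v : GL (Fin N) (LocalRing E v)) = toLocalGL E v γ) :
    ∀ᶠ v : HeightOneSpectrum (𝓞 F) in cofinite, ∀ g' : «local» E c N J v, g' ∈ localIntegralLevel c N J v →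
      (((g' : GL (Fin N) (LocalRing E v)) : Matrix (Fin N) (Fin N) (LocalRing E v))).charpoly =
          (((g v : GL (Fin N) (LocalRing E v)) : Matrix (Fin N) (Fin N) (LocalRing E v))).charpoly →
        ∃ k ∈ localIntegralLevel c N J v, k * g v * k⁻¹ = g' := by
  have hJu : IsUnit J := (Matrix.isUnit_iff_isUnit_det J).2 hJ
  filter_upwards [eventually_forall_unit_placeForm_mem_glInt (F := F) N J hJu, eventually_forall_map_mem_glInt F E γ,
    eventually_forall_placesOver E (eventually_exists_separable_lift ((γ : Matrix (Fin N) (Fin N) E).charpoly) hγ),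
    (finite_setOf_not_isUnramifiedIn' (F := F) (E := E)).compl_mem_cofinite] with v hint hγint hsep hunr g' hg' hchar
  have hv : Algebra.IsUnramifiedIn (𝓞 E) v.asIdeal := not_not.1 hunr
  obtain ⟨w⟩ := (inferInstance : Nonempty (PlacesOver E v))
  obtain ⟨q, hq, hqsep⟩ := hsep w
  by_cases hw : c • w.1 = w.1
  · exact integralConj_of_nonsplit c N J hc hJh w hw hv (isUnit_placeForm J hJu w.1) (hint w) γ (g v) (hg v) (hγint w)
      ⟨q, hq, hqsep.map⟩ g' hg' hchar
  · exact integralConj_of_split c N J hc hJh w hw (isUnit_placeForm J hJu w.1) (hint w) γ (g v) (hg v) (hγint w)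
      ⟨q, hq, hqsep.map⟩ g' hg' hchar

end AE

end Literature.NumberTheory.Automorphic.UnitaryGroup

end
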